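import Summits.ResolutionOfSingularities.ResolutionOfSingularities.Theorems.HilbertSamuelEliminationSigmaMaxModificationsCorridor3WLadderStrataCentreBareKernels
import Summits.ResolutionOfSingularities.ResolutionOfSingularities.Theorems.HilbertSamuelEliminationSigmaMaxModificationsCorridor3WLadderHybridLowCleanDefs
import Summits.ResolutionOfSingularities.ResolutionOfSingularities.Theorems.HilbertSamuelEliminationSigmaMaxModificationsCorridor3SigmaIsoBoundaryTransition
import Summits.ResolutionOfSingularities.ResolutionOfSingularities.Theorems.HilbertSamuelEliminationSigmaMaxModificationsCorridor3SigmaCyclePlusBoundaryPackage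
import Summits.ResolutionOfSingularities.ResolutionOfSingularities.Theorems.HilbertSamuelEliminationSigmaMaxModificationsCorridor3SigmaHybridScope
import HarnessLib

/-!
# [OURS · L1 W4.2] `Corridor3WLadderHybridLowCentreClean` — ROW (K-ctr)From FOR EVERY BOUNDARY-READING STRATEGY: the E-PORT
# `StrataCentreMembersCleanFromσE σ 3 ν s₀ (ē ≤ 2)` of (K-ctr), PROVED modulo F-51′ `Hironaka1970_thmIV` alone, for every functional `σ`
# admissible on the marked scope and every start `s₀ = (X, x, E₀)` at a maximal origin — the `hKctr` input of res-type-040's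
# `low_init_hybrid_of_kernels` / `maxOriginNoMovingNearChainAtQσE_low_hybrid_of_kernels` (p545386) (crux `SigmaMaxModifications`
# stmt-ResolutionOfSingularities-18506 / conjunct stmt-…-19249, line `w_ladder`, CORE (W); `--supports 19249`, helper)

Seat res-D-pv-038 (gen 9), res-L1-w42-plan-1 desk assignment 2026-08-27T16:15:26Z. Sorry-free PROOF file, no definition, no named fact beyond the
(F1♯) doors / CJS Thm. 3.6 taken BY NAME and discharged from F-51′ in §3. OURS bookkeeping for the W4.2 crux chain (cell res-hironaka); NOT a
statement of [Hironaka2017] nor of [CossartJannsenSaito2020]. AI-written; AI review is weaker than expert review.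

* §1 `centreMembersClean_bare` — stub-4's dispatch `strataCentreMembersClean_of_point_curve_geomDir` (p522551's β-twin) ALONG ONE BARE STEP
  between two maximal origins: point germ ⇒ `pointGerm_members_clean_bare`, curve germ ⇒ `curveGerm_dominant_clean_bare` (companion file
  `…Corridor3WLadderStrataCentreBareKernels`), the near-fibre exclusion at a never-isolated point by the (F1♯) near-fibre binder.
* §2 **`strataCentreMembersCleanFromσE_of_geomDir`** — for EVERY boundary-reading strategy `σ` functional at `(3, ν)` and admissible on the marked
  scope `StrategyE.ReachableState p σ 3 ν E₀`, and every maximal origin `(X, x)`: `StrataCentreMembersCleanFromσE σ 3 ν (MarkedStageE.init X x (E₀ X x))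
  (ē < 3)` modulo the (F1♯) binders `Theorem314_geomDir`, `Theorem314_nearFibre_geomDir`, `Thm314_point_locus_geomDir`, and the printed
  `ProjDir_projLine`, CJS Thm. 3.6 (stages along σE-chains are maximal origins, res-L1-type-o1's `IsMaximalOrigin.of_reachesσE`; the centre of the
  step is THE centre of the σ-step by functionality; permissibility and `V(C) ⊆ X_n(ν)` by admissibility). The bound `n₁` is `0`.
* §3 **`strataCentreMembersCleanFromσE_of_thmIV (h51 : Hironaka1970_thmIV)`** — all five inputs discharged in the tree (res-type-001 / stub-3 g4 / res-type-031 /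
  res-type-064 / res-D-lib-1), and **`strataCentreMembersCleanFromσE_hybrid_of_thmIV`** — the menu hybrid `π.hybrid (ofStageOracleE ω)` at
  `Q`-origins from admissibility on the RUN-wise scope, in the exact shape of 040's `hKctr`.

[OURS · L1 W4.2; AI-written] [cite: CossartJannsenSaito2020, Thm. 3.14, Thm. 3.6, Prop. 6.31, Def. 6.38 (ii), Rem. 6.29 (1)]
[cite: Hironaka1970NumericalCharacters, THEOREM IV p. 156]
-/

noncomputable section

set_option linter.dupNamespace false

open CategoryTheory CategoryTheory.Limits AlgebraicGeometry TopologicalSpace Topology IsLocalRing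
open Summit.ResolutionOfSingularities.ResolutionOfSingularities.Theorems.CampaignW42
open Literature.AlgebraicGeometry.Resolution Literature.RingTheory.HilbertSamuel
open Literature.AlgebraicGeometry.CossartJannsenSaito2020
open Summit.ResolutionOfSingularities.ResolutionOfSingularities.Theorems.SigmaMaxModificationsCorridor3
open Summit.ResolutionOfSingularities.ResolutionOfSingularities.Theorems.SigmaMaxModificationsCorridor3.Moving
open Scheme.IdealSheafData

universe u

/-! ## §1. The dispatch along one bare step between maximal origins -/

namespace Summit.ResolutionOfSingularities.ResolutionOfSingularities.Theorems.SigmaMaxModificationsCorridor3.Moving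

variable {ν : ℕ → ℕ}

/-- **(K-ctr) ALONG ONE BARE STEP BETWEEN MAXIMAL ORIGINS** (modulo the (F1♯) binders `Theorem314_geomDir`, `Theorem314_nearFibre_geomDir`,
`Thm314_point_locus_geomDir` and the printed `ProjDir_projLine`, CJS Thm. 3.6): for the blow-down `f : Bℓ_C(X_n) ⟶ X_n` read at a closed near point
`x′ ↦ x_n`, both stages maximal origins at level `3` (value `ν`), `C` permissible inside `X_n(ν)` through `x_n`, `ē_{x_n} ≤ 2`, `x′` NOT isolated in the
Hilbert–Samuel locus: the components of `X_{n+1}(ν)` through `x′` mapping into `V(C)` number at most one and are regular curves at `x′`. Stub-4's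
dispatch verbatim on the bare kernels. [cite: CossartJannsenSaito2020, Thm. 3.14, Thm. 3.6, Def. 3.1, Rem. 6.29 (1)] -/
theorem centreMembersClean_bare {p : ℕ} (hF : Theorem314_geomDir.{u}) (hFf : Theorem314_nearFibre_geomDir.{u}) (hPa : ProjDir_projLine.{u})
    (h314pt : Thm314_point_locus_geomDir.{u}) (h36 : CossartJannsenSaito2020_thm_3_6.{u}) {s s' : MarkedStage.{u}}
    (hO : IsMaximalOrigin p 3 ν s.W s.pt) (hO' : IsMaximalOrigin p 3 ν s'.W s'.pt) {f : s'.W ⟶ s.W} {C : s.W.IdealSheafData}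
    (hf : ∃ (L' : Labelling (blowup C)) (P' : Option (Pending (blowup C))) (h : IsLocallyNoetherian (blowup C)) (x' : ↥(blowup C)),
      (blowup.π C).base x' = s.pt ∧ IsClosed ({x'} : Set ↥(blowup C)) ∧ x' ∈ Scheme.hsStratum (blowup C) 3 ν ∧
        ∃ e : s' = ⟨blowup C, h, L', P', x'⟩, f = eqToHom (congrArg MarkedStage.W e) ≫ blowup.π C)
    (hCperm : IdealSheafData.IsPermissible C) (hCstr : (C.support : Set s.W) ⊆ Scheme.hsStratum s.W 3 ν)
    (hxC : s.pt ∈ (C.support : Set s.W)) (hG : s.geomDirDim ≤ 2) (hnI' : ¬ Iso 3 s') :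
    (∀ Z' ∈ componentsThrough 3 ν s', ∀ Z'' ∈ componentsThrough 3 ν s',
        f.base '' Z' ⊆ (C.support : Set s.W) → f.base '' Z'' ⊆ (C.support : Set s.W) → Z' = Z'') ∧
      ∀ Z' ∈ componentsThrough 3 ν s', f.base '' Z' ⊆ (C.support : Set s.W) → IsRegularCurveAt s' Z' := by
  -- standing facts at the two stages
  haveI : IsLocallyNoetherian s.W := s.ln
  haveI : IsLocallyNoetherian s'.W := s'.ln
  obtain ⟨k, _, hinv⟩ := hO.exists_cycleInv (R := fun _ _ => True)
  obtain ⟨k', _, hinv'⟩ := hO'.exists_cycleInv (R := fun _ _ => True)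
  haveI : IsNoetherian s.W := hinv.isNoetherian
  have hs'N : IsNoetherian s'.W := hinv'.isNoetherian
  have hexc : Scheme.IsExcellent s.W := hinv.isExcellent
  have hdimW : topologicalKrullDim s.W ≤ ((3 : ℕ) : WithBot ℕ∞) := hO.dim_le
  have hgdh : GeomDirHypothesis s.W s.pt := geomDirHypothesis_of_geomDirDim_le_two hG
  have hCreg : Scheme.IsRegular C.subscheme := isRegular_subscheme_of_isPermissible hCperm
  have hptn : s.pt ∈ Scheme.hsStratum s.W 3 ν := hO.mem_stratum
  have hptcl : IsClosed ({s.pt} : Set s.W) := hO.isClosed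
  have hpt' : s'.pt ∈ Scheme.hsStratum s'.W 3 ν := hO'.mem_stratum
  have hWc' : IsClosed (Scheme.hsStratum s'.W 3 ν) := hinv'.isClosed_hsStratum
  -- `f` is the blow-up in `C`, `f x′ = x_n`, `x′` near
  obtain ⟨L', P₂, h₂, x', hπ, -, -, e, hfe⟩ := id hf
  have hfpt : f.base s'.pt = s.pt := bareStep_base_pt hπ e hfe
  have hbl : IsBlowup f C := bareStep_isBlowup e hfe
  have hnear : Scheme.hsFun s'.W 3 s'.pt = Scheme.hsFun s.W 3 s.pt := by
    rw [Scheme.mem_hsStratum_iff.mp hpt', Scheme.mem_hsStratum_iff.mp hptn]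
  -- Thm. 3.14 numerical at this step, and `e ≤ ē ≤ 2`
  have h314n : ringKrullDim (s.W.presheaf.stalk s.pt ⧸ stalkIdeal C s.pt) < (dirDim s : WithBot ℕ∞) :=
    hF s.W s'.W f C 3 s'.pt s.pt hexc hCperm hbl hdimW hfpt hxC hgdh hnear
  have he2 : (dirDim s : WithBot ℕ∞) ≤ 2 := by
    have h1 : dirDim s ≤ 2 := (Scheme.dirDim_le_geomDirDim s.pt).trans hG
    exact_mod_cast h1
  -- the image closure of a member: irreducible closed, through `x_n`, inside `V(C)`
  have hA : ∀ Z' ∈ componentsThrough 3 ν s', f.base '' Z' ⊆ (C.support : Set s.W) →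
      IsIrreducible (closure (f.base '' Z')) ∧ s.pt ∈ closure (f.base '' Z') ∧
        closure (f.base '' Z') ⊆ (C.support : Set s.W) := fun Z' hZ' hZ'C =>
    ⟨((componentsIn.isIrreducible hZ'.1).image _ f.continuous.continuousOn).closure,
      subset_closure ⟨_, hZ'.2, hfpt⟩, closure_minimal hZ'C C.support.isClosed⟩
  -- a member inside the NEAR FIBRE is impossible at a never-isolated point
  have hnofibre : (dirDim s : WithBot ℕ∞) ≤ ringKrullDim (s.W.presheaf.stalk s.pt ⧸ stalkIdeal C s.pt) + 1 →
      ∀ Z' ∈ componentsThrough 3 ν s', f.base '' Z' ⊆ {s.pt} → False := by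
    intro he Z' hZ' hZ'x
    have hsub : {z : s'.W | f.base z = s.pt ∧ z ∈ Scheme.hsStratum s'.W 3 ν}.Subsingleton := by
      have key := hFf s.W s'.W f C hexc hCperm hbl 3 hdimW s.pt hxC hgdh he
      refine key.anti fun z hz => ⟨hz.1, ?_⟩
      rw [Scheme.mem_hsStratum_iff.mp hz.2, Scheme.mem_hsStratum_iff.mp hptn]
    have hZ'fib : Z' ⊆ {z : s'.W | f.base z = s.pt ∧ z ∈ Scheme.hsStratum s'.W 3 ν} :=
      fun z hz => ⟨hZ'x ⟨z, hz, rfl⟩, componentsIn.subset hZ'.1 hz⟩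
    have hZ'eq : Z' = {s'.pt} :=
      Set.Subset.antisymm (fun z hz => hsub (hZ'fib hz) (hZ'fib hZ'.2)) (Set.singleton_subset_iff.mpr hZ'.2)
    exact hinv'.singleton_notMem_componentsIn_of_not_iso hpt' hnI' (hZ'eq ▸ hZ'.1)
  by_cases hgerm : ∀ a ∈ (C.support : Set s.W), a ⤳ s.pt → a = s.pt
  · -- POINT germ: every member lies over `x_n`
    have hover : ∀ Z' ∈ componentsThrough 3 ν s', f.base '' Z' ⊆ (C.support : Set s.W) →
        f.base '' Z' ⊆ {s.pt} := by
      intro Z' hZ' hZ'C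
      obtain ⟨hirr, hxA, hAC⟩ := hA Z' hZ' hZ'C
      have hgen : IsGenericPoint hirr.genericPoint (closure (f.base '' Z')) := hirr.isGenericPoint_genericPoint isClosed_closure
      have ha : hirr.genericPoint = s.pt := hgerm _ (hAC hgen.mem) (hgen.specializes hxA)
      have hAeq : closure (f.base '' Z') = {s.pt} := by rw [← hgen.def, ha, hptcl.closure_eq]
      exact subset_closure.trans hAeq.le
    by_cases he : dirDim s = 2
    · obtain ⟨hu, hr⟩ := pointGerm_members_clean_bare hPa h314pt hf hs'N hexc hdimW hgdh hptn hWc' hCreg hCperm hxC hgerm he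
      exact ⟨fun Z' hZ' Z'' hZ'' h' h'' => hu Z' hZ' Z'' hZ'' (hover Z' hZ' h') (hover Z'' hZ'' h''),
        fun Z' hZ' h' => hr Z' hZ' (hover Z' hZ' h')⟩
    · -- `e ≤ 1`: no member at all
      have hdim0 := ringKrullDim_quotient_le_zero_of_forall_specializes C hgerm
      have hJm : stalkIdeal C s.pt ≤ maximalIdeal (s.W.presheaf.stalk s.pt) := by
        have := (mem_support_iff_stalkIdeal_le_primeOfSpecializes (specializes_refl s.pt) C).mp hxC
        rwa [Literature.AlgebraicGeometry.Resolution.primeOfSpecializes_refl] at this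
      have hJtop : stalkIdeal C s.pt ≠ ⊤ := fun h =>
        (maximalIdeal.isMaximal (s.W.presheaf.stalk s.pt)).ne_top (top_le_iff.mp (h ▸ hJm))
      haveI : Nontrivial (s.W.presheaf.stalk s.pt ⧸ stalkIdeal C s.pt) :=
        Ideal.Quotient.nontrivial_iff.mpr hJtop
      have hle : (dirDim s : WithBot ℕ∞) ≤
          ringKrullDim (s.W.presheaf.stalk s.pt ⧸ stalkIdeal C s.pt) + 1 := by
        have h1 : dirDim s ≤ 1 := by
          have : dirDim s ≤ 2 := (Scheme.dirDim_le_geomDirDim s.pt).trans hG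
          omega
        have h1' : (dirDim s : WithBot ℕ∞) ≤ 1 := by exact_mod_cast h1
        have h0 : (0 : WithBot ℕ∞) ≤ ringKrullDim (s.W.presheaf.stalk s.pt ⧸ stalkIdeal C s.pt) :=
          ringKrullDim_nonneg_of_nontrivial
        calc (dirDim s : WithBot ℕ∞) ≤ 0 + 1 := by simpa using h1'
          _ ≤ _ := add_le_add h0 le_rfl
      exact ⟨fun Z' hZ' _ _ h' _ => (hnofibre hle Z' hZ' (hover Z' hZ' h')).elim,
        fun Z' hZ' h' => (hnofibre hle Z' hZ' (hover Z' hZ' h')).elim⟩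
  · -- CURVE germ: `1 ≤ dim 𝒪_{V(C),x_n}`, no fibre member, members dominate THE component of `V(C)` through `x_n`
    push Not at hgerm
    obtain ⟨a, haC, hax, hane⟩ := hgerm
    have h1 : (1 : WithBot ℕ∞) ≤ ringKrullDim (s.W.presheaf.stalk s.pt ⧸ stalkIdeal C s.pt) :=
      one_le_ringKrullDim_quotient_stalkIdeal C hax hane haC
    have hle : (dirDim s : WithBot ℕ∞) ≤ ringKrullDim (s.W.presheaf.stalk s.pt ⧸ stalkIdeal C s.pt) + 1 := by
      refine he2.trans ?_
      have h2 : (2 : WithBot ℕ∞) = 1 + 1 := by norm_num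
      rw [h2]
      exact add_le_add h1 le_rfl
    have hlt2 : ringKrullDim (s.W.presheaf.stalk s.pt ⧸ stalkIdeal C s.pt) < 2 := h314n.trans_le he2
    -- the image closure of a member is a component of `V(C)` through `x_n`, not `{x_n}`
    have hcomp : ∀ Z' ∈ componentsThrough 3 ν s', f.base '' Z' ⊆ (C.support : Set s.W) →
        closure (f.base '' Z') ∈ componentsIn (C.support : Set s.W) ∧ closure (f.base '' Z') ≠ {s.pt} := by
      intro Z' hZ' hZ'C
      obtain ⟨hirr, hxA, hAC⟩ := hA Z' hZ' hZ'C
      have hne : closure (f.base '' Z') ≠ {s.pt} := fun heq =>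
        hnofibre hle Z' hZ' (subset_closure.trans heq.le)
      refine ⟨?_, hne⟩
      obtain ⟨D, hD, hAD⟩ := exists_componentsIn_superset C.support.isClosed (componentsIn.finite _) hirr hAC
      by_contra hnot
      have hAD' : closure (f.base '' Z') ≠ D := fun h => hnot (h ▸ hD)
      have hDirr : IsIrreducible D := componentsIn.isIrreducible hD
      have hDcl : IsClosed D := componentsIn.isClosed C.support.isClosed hD
      have hAgen : IsGenericPoint hirr.genericPoint (closure (f.base '' Z')) := hirr.isGenericPoint_genericPoint isClosed_closure
      have hDgen : IsGenericPoint hDirr.genericPoint D := hDirr.isGenericPoint_genericPoint hDcl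
      have hbx : hirr.genericPoint ⤳ s.pt := hAgen.specializes hxA
      have hηb : hDirr.genericPoint ⤳ hirr.genericPoint := hDgen.specializes (hAD hAgen.mem)
      have hne₁ : hirr.genericPoint ≠ s.pt := by
        intro h; apply hne; rw [← hAgen.def, h, hptcl.closure_eq]
      have hne₂ : hDirr.genericPoint ≠ hirr.genericPoint := by
        intro h; apply hAD'; rw [← hAgen.def, ← hDgen.def, h]
      have h2 := two_le_ringKrullDim_quotient_stalkIdeal C hbx hηb hne₁ hne₂ ((componentsIn.subset hD) hDgen.mem) (hAC hAgen.mem)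
      exact absurd (h2.trans_lt hlt2) (lt_irrefl _)
    refine ⟨fun Z' hZ' Z'' hZ'' h' h'' => ?_, fun Z' hZ' h' => ?_⟩
    · obtain ⟨hc', hne'⟩ := hcomp Z' hZ' h'
      obtain ⟨hc'', -⟩ := hcomp Z'' hZ'' h''
      have heq : closure (f.base '' Z') = closure (f.base '' Z'') :=
        eq_of_mem_componentsIn_of_isRegular hCreg hc' hc'' (hA Z' hZ' h').2.1 (hA Z'' hZ'' h'').2.1
      exact (curveGerm_dominant_clean_bare hF h314pt h36 hO hO' hf hCperm hCstr hG hc' (hA Z' hZ' h').2.1 hne').1 Z' hZ' Z'' hZ'' rfl heq.symm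
    · obtain ⟨hc', hne'⟩ := hcomp Z' hZ' h'
      exact (curveGerm_dominant_clean_bare hF h314pt h36 hO hO' hf hCperm hCstr hG hc' (hA Z' hZ' h').2.1 hne').2 Z' hZ' rfl

end Summit.ResolutionOfSingularities.ResolutionOfSingularities.Theorems.SigmaMaxModificationsCorridor3.Moving

/-! ## §2. ROW (K-ctr)From for every boundary-reading strategy, modulo the (F1♯) binders -/

namespace Summit.ResolutionOfSingularities.ResolutionOfSingularities.Theorems.SigmaMaxModificationsCorridor3.Sigma

variable {p : ℕ} {σ : StrategyE.{u}} {ν : ℕ → ℕ} {E₀ : ∀ (X : Scheme.{u}), X → Boundary X}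

/-- **ROW (K-ctr)From FOR EVERY BOUNDARY-READING STRATEGY, modulo the (F1♯) binders** (`Theorem314_geomDir`, `Theorem314_nearFibre_geomDir`,
`Thm314_point_locus_geomDir`) and the printed `ProjDir_projLine` / CJS Thm. 3.6: for `σ` FUNCTIONAL at `(3, ν)` and ADMISSIBLE on the marked scope
`StrategyE.ReachableState p σ 3 ν E₀`, from every maximal origin `(X, x)` started with `E₀ X x`, the row `StrataCentreMembersCleanFromσE σ 3 ν _ (ē < 3)`
holds with bound `n₁ = 0`: every stage σ-reached from the origin is a maximal origin (`IsMaximalOrigin.of_reachesσE`), the centre of the step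
projection is THE σ-centre (functionality), permissible inside the stratum (admissibility (a)), so §1 applies at every step.
[cite: CossartJannsenSaito2020, Thm. 3.14, Thm. 3.6, Prop. 6.31, Rem. 6.29 (1)] -/
theorem strataCentreMembersCleanFromσE_of_geomDir (hF : Theorem314_geomDir.{u}) (hFf : Theorem314_nearFibre_geomDir.{u})
    (hPa : ProjDir_projLine.{u}) (h314pt : Thm314_point_locus_geomDir.{u}) (h36 : CossartJannsenSaito2020_thm_3_6.{u})
    (hfun : σ.IsFunctional 3 ν) (hadm : IsAdmissibleStrategyOnE (StrategyE.ReachableState p σ 3 ν E₀) 3 ν σ)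
    {X : Scheme.{u}} [IsLocallyNoetherian X] {x : X} (hX : IsMaximalOrigin p 3 ν X x) :
    StrataCentreMembersCleanFromσE σ 3 ν (MarkedStageE.init X x (E₀ X x)) fun s => s.geomDirDim < 3 := by
  intro c h0 hstep hG hnI _
  refine ⟨0, fun n _ C P' hst hxC f hf => ?_⟩
  have hreach : ∀ n, ReachesσE σ 3 ν (MarkedStageE.init X x (E₀ X x)) (c n) := reachesσE_chain h0 hstep
  have hO : IsMaximalOrigin p 3 ν (c n).W (c n).pt := hX.of_reachesσE hadm (hreach n)
  have hO' : IsMaximalOrigin p 3 ν (c (n + 1)).W (c (n + 1)).pt := hX.of_reachesσE hadm (hreach (n + 1))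
  obtain ⟨hCperm, hCstr, -⟩ := hadm.step_specE (inScopeMσE_of_reachesσE hX (hreach n)) hst
  have hGn : (c n).toMarkedStage.geomDirDim ≤ 2 := Nat.le_of_lt_succ (hG n)
  -- the step projection's centre is THE centre `C` (functionality), and the step is bare
  obtain ⟨C₂, P₂, hln, x', hst₂, hπ, hcl, hx', e, hfe⟩ := hf
  obtain rfl : C₂ = C := (hfun (c n).W (c n).ln (c n).L (c n).P (c n).E).1 C₂ C P₂ P' hst₂ hst
  have e' : (c (n + 1)).toMarkedStage = ⟨blowup C₂, hln, (c n).L.next (Scheme.hsStratum (c n).W 3 ν) C₂, P₂, x'⟩ := by rw [e]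
  exact centreMembersClean_bare hF hFf hPa h314pt h36 hO hO' ⟨_, P₂, hln, x', hπ, hcl, hx', e', hfe⟩ hCperm hCstr hxC hGn (hnI (n + 1))

/-! ## §3. Modulo F-51′ alone; the menu hybrid at `Q`-origins in 040's `hKctr` shape -/

/-- **ROW (K-ctr)From FOR EVERY BOUNDARY-READING STRATEGY, MODULO F-51′ `Hironaka1970_thmIV` ALONE**: the (F1♯) binders from [H4] Th. IV
(res-type-001 `Directrix214Sharp.*`, stub-3 g4 `…Directrix214SharpNearFibre`, with the Hironaka–Grothendieck isomorphism `HerrmannIkedaOrbanz1988_cor_21_11_holds`),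
`ProjDir_projLine_holds` (res-type-031) and CJS Thm. 3.6 from Thm. 3.7 (res-type-064 / res-D-lib-1) — the same discharges as census₂'s
`strataCentreMembersClean_of_thmIV`. [cite: Hironaka1970NumericalCharacters, THEOREM IV p. 156] [cite: CossartJannsenSaito2020, Thm. 3.14, Thm. 3.6, Thm. 3.7] -/
theorem strataCentreMembersCleanFromσE_of_thmIV (h51 : Hironaka1970_thmIV.{u}) (hfun : σ.IsFunctional 3 ν)
    (hadm : IsAdmissibleStrategyOnE (StrategyE.ReachableState p σ 3 ν E₀) 3 ν σ)
    {X : Scheme.{u}} [IsLocallyNoetherian X] {x : X} (hX : IsMaximalOrigin p 3 ν X x) :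
    StrataCentreMembersCleanFromσE σ 3 ν (MarkedStageE.init X x (E₀ X x)) fun s => s.geomDirDim < 3 :=
  strataCentreMembersCleanFromσE_of_geomDir
    (Directrix214Sharp.theorem314_geomDir_of_thmIV_of_split h51 HerrmannIkedaOrbanz1988_cor_21_11_holds)
    (Directrix214Sharp.theorem314_nearFibre_geomDir_of_facts h51 HerrmannIkedaOrbanz1988_cor_21_11_holds) ProjDir_projLine_holds
    (Directrix214Sharp.thm314_point_locus_geomDir_of_thmIV_point (Hironaka1970_thmIV_point_of_thmIV h51))
    (CossartJannsenSaito2020_thm_3_6_of_thm_3_7 CossartJannsenSaito2020_thm_3_7_holds) hfun hadm hX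

/-- Admissibility on the RUN-wise scope gives admissibility on the marked scope (the marked scope is smaller). [folklore] -/
theorem isAdmissibleStrategyOnE_reachable_of_runReachable
    (hadm : IsAdmissibleStrategyOnE (StrategyE.RunReachableState p σ 3 ν E₀) 3 ν σ) :
    IsAdmissibleStrategyOnE (StrategyE.ReachableState p σ 3 ν E₀) 3 ν σ :=
  fun W hW L P E hS => hadm W hW L P E (StrategyE.reachableState_subset_runReachableState hS)

/-- **040's `hKctr` FOR THE MENU HYBRID, MODULO F-51′ ALONE**: for `π`, `ω` functional and the hybrid `π.hybrid (ofStageOracleE ω)` admissible on its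
run-wise scope (every `ν`), at every `Q`-maximal origin the row (K-ctr)From holds in grade `ē < 3` — the exact input shape of
`maxOriginNoMovingNearChainAtQσE_low_hybrid_of_kernels` (p545386). [cite: Hironaka1970NumericalCharacters, THEOREM IV p. 156] [cite: CossartJannsenSaito2020, Thm. 3.14, Rem. 6.29 (1)] -/
theorem strataCentreMembersCleanFromσE_hybrid_of_thmIV (h51 : Hironaka1970_thmIV.{u}) {π : StrategyE.{u}} {ω : StageOracleE.{u}}
    {Q : ℕ → (ℕ → ℕ) → ∀ X : Scheme.{u}, X → Prop} {E₀ : ∀ X : Scheme.{u}, Boundary X}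
    (hπ : ∀ ν, π.IsFunctional 3 ν) (hω : OracleFunctionalΩE ω)
    (hadm : ∀ ν, IsAdmissibleStrategyOnE
      (StrategyE.RunReachableState p (π.hybrid (StrategyE.ofStageOracleE ω)) 3 ν fun X _ => E₀ X) 3 ν
      (π.hybrid (StrategyE.ofStageOracleE ω))) :
    ∀ (ν : ℕ → ℕ) (X : Scheme.{u}) [IsLocallyNoetherian X] (x : X), IsMaximalOrigin p 3 ν X x → Q 3 ν X x →
      StrataCentreMembersCleanFromσE (π.hybrid (StrategyE.ofStageOracleE ω)) 3 ν (MarkedStageE.init X x (E₀ X))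
        fun s => s.geomDirDim < 3 :=
  fun ν _ _ _ hX _ =>
    strataCentreMembersCleanFromσE_of_thmIV (E₀ := fun X _ => E₀ X) h51 ((hπ ν).hybrid (StrategyE.isFunctional_ofStageOracleE hω 3 ν))
      (isAdmissibleStrategyOnE_reachable_of_runReachable (hadm ν)) hX

end Summit.ResolutionOfSingularities.ResolutionOfSingularities.Theorems.SigmaMaxModificationsCorridor3.Sigma

end
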